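import Mathlib
import Summits.ValiantsHypothesis.ValiantsHypothesis.Theses.FeketeSOS

/-!
# Crux `FeketeSOS.CharPSparseSOS` (stmt-ValiantsHypothesis-14989), line `Sketch-ideator5` —
# the transfer stub is implied by the crux (calibration record)

The line's skeleton (`Cruxes/CharPSparseSOS/Lines/Sketch_ideator5.lean`) closes the crux from K1 (`stub_traceBias`)
and the transfer `stub_transfer` ("every cheap cyclic representation of `F̄_p` in characteristic `p` yields ONE set `Q`
in the window `#Q ≤ √p + p^{δ_w}` that beats the robust-Shkredov bound").  This file records the converse direction
`CharPSparseSOS → stub_transfer` (vacuously: under the crux there are no cheap representations for large `p`), so that,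
given K1, the transfer stub is EQUIVALENT to the crux — it carries no content of its own beyond the far side of
p112874.  Together with the reach computation of `Lines/Sketch-ideator5-dead.md` §3 this is why line `Sketch-ideator5`
is closed as dead at `stub_transfer`.
-/

-- `Summit.ValiantsHypothesis.ValiantsHypothesis.…` is the tree's mandated single-conjunct layout (Sub = Summit).
set_option linter.dupNamespace false

namespace Summit.ValiantsHypothesis.ValiantsHypothesis.Theorems.CharPSparseSOSTraceBias

open Polynomial Finset

/-- **The crux implies the transfer stub** (with `δ_w = 1/4` and `δ_t` the crux's own exponent): a cyclic
representation with `s ≤ p^{δ}` squares and support-sum `< p^{1/2+δ}` contradicts `CharPSparseSOS` for `p ≥ p₀`, so the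
conclusion holds vacuously.  Hence `stub_transfer` of line `Sketch-ideator5` is the crux modulo K1. -/
theorem transfer_of_charPSparseSOS :
    Summit.ValiantsHypothesis.ValiantsHypothesis.Theses.FeketeSOS.CharPSparseSOS →
    ∃ δw : ℝ, 0 < δw ∧ δw < 1 / 2 ∧ ∃ δt : ℝ, 0 < δt ∧ ∃ p₀ : ℕ, ∀ (p : ℕ) [Fact p.Prime], p₀ ≤ p →
      ∀ (K : Type) [Field K] [CharP K p] (s : ℕ) (c : Fin s → K) (g : Fin s → K[X]),
      (s : ℝ) ≤ (p : ℝ) ^ δt → (∀ i, (g i).natDegree < p) →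
      ((X : K[X]) ^ p - 1 ∣ (∑ i, C (c i) * g i ^ 2) -
          ∑ m ∈ range p, C ((legendreSym p m : ℤ) : K) * X ^ m) →
      (∑ i, ((g i).support.card : ℝ)) < (p : ℝ) ^ (1 / 2 + δt) →
      ∃ Q : Finset ℕ, (∀ a ∈ Q, a < p) ∧ (Q.card : ℝ) ≤ Real.sqrt p + (p : ℝ) ^ δw ∧
        3 * (Q.card : ℝ) +
          2 * (((range p).filter (fun n => ((Q ×ˢ Q).filter
              (fun ab : ℕ × ℕ => ab.1 < ab.2 ∧ (ab.1 + ab.2) % p = n)).card ≠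
                (if n ≠ 0 ∧ legendreSym p n = 1 then 1 else 0))).card : ℝ) +
          13 * Real.sqrt p + 13 < (p : ℝ) ^ (1 / 2 + δw) := by
  rintro ⟨δ, hδ, p₀, h⟩
  refine ⟨1 / 4, by norm_num, by norm_num, δ, hδ, p₀, ?_⟩
  intro p _ hp K _ _ s c g hs hdeg hdvd hT
  exfalso
  have := h p hp K s c g hs hdeg hdvd
  linarith

end Summit.ValiantsHypothesis.ValiantsHypothesis.Theorems.CharPSparseSOSTraceBias
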